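import Literature.MathematicalPhysics.QuantumFieldTheory.Balaban1983to89.B5Hk163Strip

/-!
# `Balaban1983to89.B5Hk163Qk` — «Q_kH_kB = B» verified FROM (1.63), at the symbol level (kernel certificate of a p. 29 sentence)

T. Bałaban, *Propagators and renormalization transformations for lattice gauge theories. I*, Commun. Math.
Phys. **95**, 17–40 (1984) [`Balaban1984PropagatorsI`, cell paper B5].  TEXT LOCATIONS (renders
`…1984-cmp95-propagators-rt-I-p012-x2.png` = p. 28 [PDF 12] and `…-p013-x2.png` = p. 29 [PDF 13], read as
images this session), verbatim:

* p. 28, (1.61): «(Q_kA)~_μ(p′) = Σ_l u(p′+l) v_μ(p′+l) Ã_μ(p′+l),  v_μ(p) = ∂¹_μ(p′)/∂_μ(p)»;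
  (1.62): «φ_μ(p′) = Σ_l |u(p′+l)|²|v_μ(p′+l)|²/Δ(p′+l)»; (1.63): the two printed expressions for
  `(H_kB)~_μ(p′+l)`, typed VERBATIM and symbol-agnostically in `B5Symbol163` (`first163` = first expression
  with the bars of (1.60)/(1.62), `firstPrinted163` = first expression with the bars AS PRINTED, `second163`).
* p. 29, the sentence after (1.63) and the Hölder remark: «Using (1.60), or better (1.63), we can verify all
  the properties of H_kB: Q_kH_kB = B, R∂*H_kB = 0, H_kB is a minimum of ½⟨∂A, ∂A⟩ on the hyperplane
  {A : Q_kA = B, R∂*A = 0}, …».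

## What this module certifies (sorry-free; all `[folklore]` audit algebra; `[cite: …]` = text locations only)

THE FIRST of the listed properties, `Q_kH_kB = B`, read through (1.61) at the SYMBOL level — i.e. the
finite alias-sum identity `Σ_l u(p′+l) v_μ(p′+l) (H_kB)~_μ(p′+l) = B̃_μ(p′)` for the typed (1.63):

* §1 (symbol-agnostic, over `B5Symbol163`'s arbitrary finite alias type `ι`, direction type `κ`, complex
  families `u, v, ∂_μ, Δ, Δ₀, ∂¹, φ_ν, B̃`): `qk_head163` (the head term alone averages to `B̃_μ`: this is
  `Q_kΔ⁻¹Q_k*φ⁻¹ = φφ⁻¹`), `qk_bracket163` (the bracket averages to `∂¹_μ(p′) − ∂¹_μ(p′) = 0`: this is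
  `Q_k∂Δ⁻²Q′_k*(Q′_kΔ⁻²Q′_k*)⁻¹ − Q_kΔ⁻¹Q_k*φ⁻¹∂₁ = ∂₁ − ∂₁`, using `v_μ(p′+l)∂_μ(p′+l) = ∂¹_μ(p′)`, (1.61)
  read multiplicatively), hence **`qk_first163`** / **`qk_second163`**:
  `Σ_l u v_μ(p′+l)·first163(l) = Σ_l u v_μ(p′+l)·second163(l) = B̃_μ(p′)` for EVERY `B̃`, given only
  `Δ₀(p′) ≠ 0`, `S(p′) = Σ_l |u|²Δ₀²/Δ² ≠ 0`, `φ_μ(p′) ≠ 0` (real-data forms `…_of_pos`; `…_vOf` with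
  `v = ∂¹/∂` literally).
* §1 `qk_firstPrinted163` / `qk_firstPrinted163_eq_iff`: with the PRINTED bar placement of the first
  expression the same averaging gives `B̃_μ + (∂¹_μ(p′) − \overline{∂¹_μ(p′)})·T(p′; B̃)`, so the printed first
  expression satisfies Bałaban's own property `Q_kH_kB = B` iff `∂¹_μ(p′) ∈ ℝ` or the tail factor `T`
  vanishes — a purely ALGEBRAIC engine for the bar correction recorded in cell GAPS G-B5-14 (ii) / C-adv4-31
  (previous engines: numerics, `B5Symbol163` §3, prose).
* §2 (typed, on the torus leaves of `B5Prop11Fiber` at real `p′ = s ∈ [−π,π]^d ∖ {0}`, `Δ₀ = Delta1r`,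
  `φ_ν = B5Bounds167Lattice.phi162`, via `B5Hk163Strip.second163_eq_sum_h163`): **`qk_sum_h163`**
  `Σ_l uSym·vSym_μ(l)·(Σ_λ h163_{μλ}(l; p′) B̃_λ) = B̃_μ` and **`qk_h163`** `Σ_l uSym·vSym_μ(l)·h163_{μλ}(l; p′) = δ_{μλ}`
  for every `n ≥ 1` — the kernel form of the cell's numerical check (`b2b-balaban-beta-lit3-g8/haff/check_QH.py`,
  residual ≤ 4.6·10⁻¹⁶), and independent of `B5.hk_props` (which derives `Q_kH_k = I` from the operator algebra
  (1.95) + (1.103), not from (1.63)).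

## Honest scope

* SYMBOL LEVEL ONLY: that (1.61)/(1.63) ARE the momentum representations of Bałaban's operators `Q_k`, `H_k`
  on `T_η` (the Fourier dictionary) is NOT certified here (cell GAPS G-b05g10-4); `p′ = 0` («defined as a
  limit») is not treated; `R∂*H_kB = 0` and the minimum property are NOT claimed.
* `U = 1`, `m² = 0`; nothing printed is used as a hypothesis (ABSOLUTE RULE); value = audit certificate of one
  printed sentence, NOT summit progress.
-/

open scoped BigOperators ComplexConjugate
open Finset Complex

namespace Literature.MathematicalPhysics.QuantumFieldTheory.Balaban1983to89.B5Hk163Qk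

open Literature.MathematicalPhysics.QuantumFieldTheory.Balaban1983to89.B5Symbol163

noncomputable section

/-! ## §1. The averaging identity, symbol-agnostically -/

section Agnostic

variable {ι : Type*} [Fintype ι] {κ : Type*}

/-- `z·w·\overline{(z·w)} = |z|²·|w|²`. [folklore] -/
theorem mul_mul_conj_mul163 (z w : ℂ) : z * w * conj (z * w) = (normSq z : ℂ) * (normSq w : ℂ) := by
  rw [map_mul, normSq_eq_conj_mul_self, normSq_eq_conj_mul_self]; ring

/-- HEAD: `Σ_l u v_μ(p′+l)·[Δ₀/Δ(p′+l)·\overline{u v_μ}(p′+l)·(Δ₀φ_μ)⁻¹·B̃_μ] = φ_μ·Δ₀(Δ₀φ_μ)⁻¹·B̃_μ = B̃_μ`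
(`Q_kΔ⁻¹Q_k*φ⁻¹ = 1` by (1.62)). [folklore] -/
theorem qk_head163 (u v : ι → ℂ) (D : ι → ℂ) (Δ₀ : ℂ) (Bt : κ → ℂ) (μ : κ) (hΔ : Δ₀ ≠ 0)
    (hφ : phiSym u v D ≠ 0) : ∑ l, u l * v l * head163 u v D Δ₀ Bt μ l = Bt μ := by
  have e : ∀ l, u l * v l * head163 u v D Δ₀ Bt μ l
      = (Δ₀ * (1 / (Δ₀ * phiSym u v D)) * Bt μ) * ((normSq (u l) : ℂ) * (normSq (v l) : ℂ) / D l) := by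
    intro l
    calc u l * v l * head163 u v D Δ₀ Bt μ l
        = (u l * v l * conj (u l * v l)) * (Δ₀ / D l) * (1 / (Δ₀ * phiSym u v D)) * Bt μ := by
          rw [head163]; ring
      _ = _ := by rw [mul_mul_conj_mul163]; ring
  rw [sum_congr rfl (fun l _ => e l), ← mul_sum]
  have hφ' : ∑ l, (normSq (u l) : ℂ) * (normSq (v l) : ℂ) / D l = phiSym u v D := rfl
  rw [hφ']
  field_simp

/-- FIRST BRACKET TERM: `Σ_l u v_μ ∂_μ(p′+l) ū Δ₀²/Δ²(p′+l)·S⁻¹ = ∂¹_μ(p′)·S·S⁻¹ = ∂¹_μ(p′)`, by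
`v_μ(p′+l)∂_μ(p′+l) = ∂¹_μ(p′)` (`Q_k∂ = ∂₁Q′_k`). [folklore] -/
theorem qk_bracketA163 (u v dμ : ι → ℂ) (D : ι → ℂ) (Δ₀ : ℂ) (dOne : κ → ℂ) (μ : κ)
    (hS : sSym u D Δ₀ ≠ 0) (h161 : ∀ l, dOne μ = v l * dμ l) :
    ∑ l, u l * v l * (dμ l * (conj (u l) * Δ₀ ^ 2 / D l ^ 2) * (sSym u D Δ₀)⁻¹) = dOne μ := by
  have e : ∀ l, u l * v l * (dμ l * (conj (u l) * Δ₀ ^ 2 / D l ^ 2) * (sSym u D Δ₀)⁻¹)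
      = dOne μ * (sSym u D Δ₀)⁻¹ * ((normSq (u l) : ℂ) * Δ₀ ^ 2 / D l ^ 2) := by
    intro l; rw [h161 l, normSq_eq_conj_mul_self]; ring
  rw [sum_congr rfl (fun l _ => e l), ← mul_sum]
  have hS' : ∑ l, (normSq (u l) : ℂ) * Δ₀ ^ 2 / D l ^ 2 = sSym u D Δ₀ := rfl
  rw [hS', inv_mul_cancel_right₀ hS]

/-- SECOND BRACKET TERM (with an arbitrary last factor `X`, to serve both bar placements):
`Σ_l u v_μ·\overline{u v_μ}(p′+l) Δ₀/Δ(p′+l)·(Δ₀φ_μ)⁻¹·X = X`. [folklore] -/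
theorem qk_bracketB163 (u v : ι → ℂ) (D : ι → ℂ) (Δ₀ X : ℂ) (hΔ : Δ₀ ≠ 0) (hφ : phiSym u v D ≠ 0) :
    ∑ l, u l * v l * (conj (u l * v l) * Δ₀ / D l * (1 / (Δ₀ * phiSym u v D)) * X) = X := by
  have e : ∀ l, u l * v l * (conj (u l * v l) * Δ₀ / D l * (1 / (Δ₀ * phiSym u v D)) * X)
      = (X * (Δ₀ * (1 / (Δ₀ * phiSym u v D)))) * ((normSq (u l) : ℂ) * (normSq (v l) : ℂ) / D l) := by
    intro l
    calc u l * v l * (conj (u l * v l) * Δ₀ / D l * (1 / (Δ₀ * phiSym u v D)) * X)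
        = (u l * v l * conj (u l * v l)) * (Δ₀ / D l) * (1 / (Δ₀ * phiSym u v D)) * X := by ring
      _ = _ := by rw [mul_mul_conj_mul163]; ring
  rw [sum_congr rfl (fun l _ => e l), ← mul_sum]
  have hφ' : ∑ l, (normSq (u l) : ℂ) * (normSq (v l) : ℂ) / D l = phiSym u v D := rfl
  rw [hφ']
  field_simp

/-- THE BRACKET AVERAGES TO ZERO: `Σ_l u v_μ(p′+l)·bracket163(l) = ∂¹_μ(p′) − ∂¹_μ(p′) = 0`. [folklore] -/
theorem qk_bracket163 (u v dμ : ι → ℂ) (D : ι → ℂ) (Δ₀ : ℂ) (dOne : κ → ℂ) (μ : κ) (hΔ : Δ₀ ≠ 0)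
    (hS : sSym u D Δ₀ ≠ 0) (hφ : phiSym u v D ≠ 0) (h161 : ∀ l, dOne μ = v l * dμ l) :
    ∑ l, u l * v l * bracket163 u v dμ D Δ₀ dOne μ l = 0 := by
  simp only [bracket163, mul_sub, sum_sub_distrib]
  rw [qk_bracketA163 u v dμ D Δ₀ dOne μ hS h161, qk_bracketB163 u v D Δ₀ (dOne μ) hΔ hφ, sub_self]

/-- **`Q_kH_kB = B` FROM THE FIRST EXPRESSION OF (1.63)** (bars of (1.60)/(1.62)): for every `B̃`,
`Σ_l u(p′+l) v_μ(p′+l)·first163(l) = B̃_μ(p′)`, given `Δ₀(p′), S(p′), φ_μ(p′) ≠ 0` and (1.61) read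
multiplicatively. [cite: Balaban1984PropagatorsI, p.29 «Q_kH_kB = B» (text); (1.61), (1.63) p.28] [folklore] -/
theorem qk_first163 [Fintype κ] (u v dμ : ι → ℂ) (D : ι → ℂ) (Δ₀ : ℂ) (dOne phiDir Bt : κ → ℂ)
    (μ : κ) (hΔ : Δ₀ ≠ 0) (hS : sSym u D Δ₀ ≠ 0) (hφ : phiSym u v D ≠ 0) (h161 : ∀ l, dOne μ = v l * dμ l) :
    ∑ l, u l * v l * first163 u v dμ D Δ₀ dOne phiDir Bt μ l = Bt μ := by
  have e : ∀ l, u l * v l * first163 u v dμ D Δ₀ dOne phiDir Bt μ l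
      = u l * v l * head163 u v D Δ₀ Bt μ l
        + u l * v l * bracket163 u v dμ D Δ₀ dOne μ l
          * ((nSym dOne phiDir Δ₀)⁻¹ * ∑ lam, conj (dOne lam) / (Δ₀ * phiDir lam) * Δ₀⁻¹ * Bt lam) := by
    intro l; rw [first163]; ring
  rw [sum_congr rfl (fun l _ => e l), sum_add_distrib, ← sum_mul, qk_head163 u v D Δ₀ Bt μ hΔ hφ,
    qk_bracket163 u v dμ D Δ₀ dOne μ hΔ hS hφ h161, zero_mul, add_zero]

/-- **`Q_kH_kB = B` FROM THE SECOND EXPRESSION OF (1.63)** (same hypotheses; via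
`B5Symbol163.first163_eq_second163_of_eq_mul`). [cite: Balaban1984PropagatorsI, p.29 «Q_kH_kB = B» (text);
(1.63) p.28] [folklore] -/
theorem qk_second163 [DecidableEq ι] [Fintype κ] (u v dμ : ι → ℂ) (D : ι → ℂ) (Δ₀ : ℂ)
    (dOne phiDir Bt : κ → ℂ) (μ : κ) (hΔ : Δ₀ ≠ 0) (hS : sSym u D Δ₀ ≠ 0) (hφ : phiSym u v D ≠ 0) (h161 : ∀ l, dOne μ = v l * dμ l) :
    ∑ l, u l * v l * second163 u v dμ D Δ₀ dOne phiDir Bt μ l = Bt μ := by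
  rw [← qk_first163 u v dμ D Δ₀ dOne phiDir Bt μ hΔ hS hφ h161]
  exact sum_congr rfl (fun l _ => by
    rw [first163_eq_second163_of_eq_mul u v dμ D Δ₀ dOne phiDir Bt μ hΔ hS hφ l (h161 l)])

omit [Fintype ι] in
/-- (1.61) literally, `v_μ = ∂¹_μ(p′)/∂_μ(p′+·)` (`vOf`), gives the multiplicative relation as soon as
`∂¹_μ(p′) = 0` wherever `∂_μ(p′+l) = 0` (the removable point; automatic for Bałaban's symbols,
`B5Prop11Fiber.d1Sym_eq_zero_of`). [folklore] -/
theorem vOf_mul_eq163 (dOneμ : ℂ) (dμ : ι → ℂ) (hd : ∀ l, dμ l = 0 → dOneμ = 0) (l : ι) :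
    dOneμ = vOf dOneμ dμ l * dμ l := by
  unfold vOf
  rcases eq_or_ne (dμ l) 0 with h | h
  · rw [h, mul_zero]; exact hd l h
  · rw [div_mul_cancel₀ _ h]

/-- `Q_kH_kB = B` with `v = ∂¹/∂` literally as in (1.61). [folklore] -/
theorem qk_first163_vOf [Fintype κ] (u dμ : ι → ℂ) (D : ι → ℂ) (Δ₀ : ℂ) (dOne phiDir Bt : κ → ℂ)
    (μ : κ) (hΔ : Δ₀ ≠ 0) (hS : sSym u D Δ₀ ≠ 0) (hφ : phiSym u (vOf (dOne μ) dμ) D ≠ 0)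
    (hd : ∀ l, dμ l = 0 → dOne μ = 0) :
    ∑ l, u l * vOf (dOne μ) dμ l * first163 u (vOf (dOne μ) dμ) dμ D Δ₀ dOne phiDir Bt μ l = Bt μ :=
  qk_first163 u _ dμ D Δ₀ dOne phiDir Bt μ hΔ hS hφ (vOf_mul_eq163 (dOne μ) dμ hd)

/-- `Q_kH_kB = B`, real-data form: `Δ(p′+l) > 0`, `Δ₀(p′) > 0`, one alias `l₀` with `u(p′+l₀)v_μ(p′+l₀) ≠ 0`,
(1.61) multiplicatively — for the first expression. [folklore] -/
theorem qk_first163_of_pos [Fintype κ] (u v dμ : ι → ℂ) (Dr : ι → ℝ) (Δ₀r : ℝ)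
    (dOne phiDir Bt : κ → ℂ) (μ : κ) (hD : ∀ l, 0 < Dr l) (hΔ : 0 < Δ₀r) (l₀ : ι) (hu : u l₀ ≠ 0) (hvl : v l₀ ≠ 0)
    (hv : ∀ l, dOne μ = v l * dμ l) :
    ∑ l, u l * v l * first163 u v dμ (fun l => (Dr l : ℂ)) (Δ₀r : ℂ) dOne phiDir Bt μ l = Bt μ :=
  qk_first163 u v dμ _ _ dOne phiDir Bt μ (ofReal_ne_zero.mpr hΔ.ne') (sSym_ne_zero u Dr Δ₀r hD hΔ l₀ hu)
    (phiSym_ne_zero u v Dr hD l₀ hu hvl) hv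

/-- the same for the second expression. [folklore] -/
theorem qk_second163_of_pos [DecidableEq ι] [Fintype κ] (u v dμ : ι → ℂ) (Dr : ι → ℝ) (Δ₀r : ℝ)
    (dOne phiDir Bt : κ → ℂ) (μ : κ) (hD : ∀ l, 0 < Dr l) (hΔ : 0 < Δ₀r) (l₀ : ι) (hu : u l₀ ≠ 0) (hvl : v l₀ ≠ 0)
    (hv : ∀ l, dOne μ = v l * dμ l) :
    ∑ l, u l * v l * second163 u v dμ (fun l => (Dr l : ℂ)) (Δ₀r : ℂ) dOne phiDir Bt μ l = Bt μ :=
  qk_second163 u v dμ _ _ dOne phiDir Bt μ (ofReal_ne_zero.mpr hΔ.ne') (sSym_ne_zero u Dr Δ₀r hD hΔ l₀ hu)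
    (phiSym_ne_zero u v Dr hD l₀ hu hvl) hv

/-- **THE PRINTED BARS VIOLATE `Q_kH_kB = B`**: with the bar placement of the first expression AS PRINTED
(`\overline{∂¹_μ(p′)}` inside the bracket, no bar in `Σ_λ`) the averaging gives
`B̃_μ + (∂¹_μ(p′) − \overline{∂¹_μ(p′)})·T`, `T = N⁻¹Σ_λ ∂¹_λ/(Δ₀φ_λ)·Δ₀⁻¹B̃_λ`. [folklore] -/
theorem qk_firstPrinted163 [Fintype κ] (u v dμ : ι → ℂ) (D : ι → ℂ) (Δ₀ : ℂ) (dOne phiDir Bt : κ → ℂ)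
    (μ : κ) (hΔ : Δ₀ ≠ 0) (hS : sSym u D Δ₀ ≠ 0) (hφ : phiSym u v D ≠ 0) (h161 : ∀ l, dOne μ = v l * dμ l) :
    ∑ l, u l * v l * firstPrinted163 u v dμ D Δ₀ dOne phiDir Bt μ l
      = Bt μ + (dOne μ - conj (dOne μ))
          * ((nSym dOne phiDir Δ₀)⁻¹ * ∑ lam, dOne lam / (Δ₀ * phiDir lam) * Δ₀⁻¹ * Bt lam) := by
  have e : ∀ l, u l * v l * firstPrinted163 u v dμ D Δ₀ dOne phiDir Bt μ l
      = u l * v l * head163 u v D Δ₀ Bt μ l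
        + (u l * v l * (dμ l * (conj (u l) * Δ₀ ^ 2 / D l ^ 2) * (sSym u D Δ₀)⁻¹)
            - u l * v l * (conj (u l * v l) * Δ₀ / D l * (1 / (Δ₀ * phiSym u v D)) * conj (dOne μ)))
          * ((nSym dOne phiDir Δ₀)⁻¹ * ∑ lam, dOne lam / (Δ₀ * phiDir lam) * Δ₀⁻¹ * Bt lam) := by
    intro l; rw [firstPrinted163]; ring
  rw [sum_congr rfl (fun l _ => e l), sum_add_distrib, ← sum_mul, sum_sub_distrib,
    qk_head163 u v D Δ₀ Bt μ hΔ hφ, qk_bracketA163 u v dμ D Δ₀ dOne μ hS h161,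
    qk_bracketB163 u v D Δ₀ (conj (dOne μ)) hΔ hφ]

/-- hence the printed first expression satisfies `Q_kH_kB = B` (in the component `μ`, for the datum `B̃`)
iff `∂¹_μ(p′)` is real or the tail factor vanishes. [folklore] -/
theorem qk_firstPrinted163_eq_iff [Fintype κ] (u v dμ : ι → ℂ) (D : ι → ℂ) (Δ₀ : ℂ) (dOne phiDir Bt : κ → ℂ)
    (μ : κ) (hΔ : Δ₀ ≠ 0) (hS : sSym u D Δ₀ ≠ 0) (hφ : phiSym u v D ≠ 0)
    (h161 : ∀ l, dOne μ = v l * dμ l) :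
    ∑ l, u l * v l * firstPrinted163 u v dμ D Δ₀ dOne phiDir Bt μ l = Bt μ
      ↔ dOne μ = conj (dOne μ)
        ∨ (nSym dOne phiDir Δ₀)⁻¹ * ∑ lam, dOne lam / (Δ₀ * phiDir lam) * Δ₀⁻¹ * Bt lam = 0 := by
  rw [qk_firstPrinted163 u v dμ D Δ₀ dOne phiDir Bt μ hΔ hS hφ h161, ← sub_eq_zero (a := dOne μ),
    ← mul_eq_zero]
  constructor
  · intro h; linear_combination h
  · intro h; linear_combination h

end Agnostic

/-! ## §2. Typed: Bałaban's torus symbols at real momenta `p′ ∈ [−π,π]^d ∖ {0}` -/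

section Torus

open Literature.MathematicalPhysics.QuantumFieldTheory.Balaban1983to89.B4Strip
open Literature.MathematicalPhysics.QuantumFieldTheory.Balaban1983to89.B5Prop11Leaves
open Literature.MathematicalPhysics.QuantumFieldTheory.Balaban1983to89.B5Prop11Fiber
open Literature.MathematicalPhysics.QuantumFieldTheory.Balaban1983to89.B5Bounds167Lattice
open Literature.MathematicalPhysics.QuantumFieldTheory.Balaban1983to89.B5Hk163Strip

variable {d : ℕ} (n : ℕ) [NeZero n]

/-- the zero-alias leaves do not vanish on the zone: `|u(p′)v_μ(p′)|² ≥ (4/π²)^{d+1}` (`B4Strip.Ur_zero_ge`,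
`uFactorr_zero_ge`), so `u(p′) ≠ 0` and `v_μ(p′) ≠ 0`. [folklore] -/
theorem uSym_vSym_zero_ne_zero (hn : 1 ≤ n) (s : Fin d → ℝ) (hs : ∀ ν, |s ν| ≤ Real.pi) (μ : Fin d) :
    uSym n (fun _ => 0) s ≠ 0 ∧ vSym n (fun _ => 0) s μ ≠ 0 := by
  have hb : (4 / Real.pi ^ 2) ^ (d + 1) ≤ ‖uSym n (fun _ => 0) s * vSym n (fun _ => 0) s μ‖ ^ 2 := by
    rw [norm_mul, mul_pow, norm_uSym_sq n hn _ s hs, norm_vSym_sq n hn _ s μ (hs μ), pow_succ,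
      Fin.val_zero]
    exact mul_le_mul (Ur_zero_ge n hn s hs) (uFactorr_zero_ge n hn (s μ) (hs μ)) (by positivity)
      (Ur_nonneg _ _ _)
  have hne : uSym n (fun _ => 0) s * vSym n (fun _ => 0) s μ ≠ 0 := by
    intro h
    rw [h, norm_zero, zero_pow two_ne_zero] at hb
    have : (0 : ℝ) < (4 / Real.pi ^ 2) ^ (d + 1) := by positivity
    linarith
  exact mul_ne_zero_iff.mp hne

/-- **`Q_kH_kB = B` FOR THE TYPED (1.61)/(1.63) ON THE TORUS.**  For `n ≥ 1`, `p′ = s ∈ [−π,π]^d`, `s ≠ 0`,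
every `μ` and every `B̃ : Fin d → ℂ`:
`Σ_l u(p′+l) v_μ(p′+l) · (Σ_λ h163_{μλ}(l; p′) B̃_λ) = B̃_μ(p′)`
(`u = uSym`, `v_μ = vSym`, `(H_kB)~_μ(p′+l) = Σ_λ h163 B̃_λ` by `B5Hk163Strip.second163_eq_sum_h163`).
[cite: Balaban1984PropagatorsI, p.29 «Q_kH_kB = B» (text); (1.61)–(1.63) p.28] [folklore] -/
theorem qk_sum_h163 (hn : 1 ≤ n) (s : Fin d → ℝ) (hs : ∀ ν, |s ν| ≤ Real.pi) (ν₀ : Fin d)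
    (hν₀ : s ν₀ ≠ 0) (μ : Fin d) (Bt : Fin d → ℂ) :
    ∑ k : Fin d → Fin n, uSym n k s * vSym n k s μ * ∑ lam, h163 n μ lam k (ofRealVec s) * Bt lam
      = Bt μ := by
  have e : ∀ k : Fin d → Fin n, ∑ lam, h163 n μ lam k (ofRealVec s) * Bt lam
      = second163 (fun l : Fin d → Fin n => uSym n l s) (fun l => vSym n l s μ) (fun l => dSym n l s μ)
          (fun l => ((DeltaXir n 0 (shiftr n l s) : ℝ) : ℂ)) ((Delta1r 0 s : ℝ) : ℂ) (d1Sym s)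
          (fun ν => ((phi162 n ν s : ℝ) : ℂ)) Bt μ k :=
    fun k => (second163_eq_sum_h163 n hn s hs ν₀ hν₀ μ k Bt).symm
  rw [sum_congr rfl (fun k _ => by rw [e k])]
  have huv := uSym_vSym_zero_ne_zero n hn s hs μ
  refine qk_second163_of_pos (fun l : Fin d → Fin n => uSym n l s) (fun l => vSym n l s μ)
    (fun l => dSym n l s μ) (fun l => DeltaXir n 0 (shiftr n l s)) (Delta1r 0 s) (d1Sym s)
    (fun ν => ((phi162 n ν s : ℝ) : ℂ)) Bt μ ?_ (Delta1r_pos s hs ν₀ hν₀) (fun _ => 0) huv.1 huv.2 ?_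
  · intro l
    exact (Delta1r_pos s hs ν₀ hν₀).trans_le (Delta1r_le_DeltaXir_shift n hn l s)
  · intro l
    exact d1Sym_eq_vSym_mul n hn l s μ

/-- **THE MULTIPLIER FORM**: `Σ_l u(p′+l) v_μ(p′+l) · h163_{μλ}(l; p′) = δ_{μλ}` on the punctured zone, every
`n ≥ 1` (the kernel form of the cell's numerical `check_QH`). [folklore] -/
theorem qk_h163 (hn : 1 ≤ n) (s : Fin d → ℝ) (hs : ∀ ν, |s ν| ≤ Real.pi) (ν₀ : Fin d) (hν₀ : s ν₀ ≠ 0)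
    (μ lam : Fin d) :
    ∑ k : Fin d → Fin n, uSym n k s * vSym n k s μ * h163 n μ lam k (ofRealVec s)
      = if μ = lam then 1 else 0 := by
  have h := qk_sum_h163 n hn s hs ν₀ hν₀ μ (fun ν => if ν = lam then 1 else 0)
  simp only [mul_ite, mul_one, mul_zero, Finset.sum_ite_eq', Finset.mem_univ, if_true] at h
  exact h

end Torus

end

end Literature.MathematicalPhysics.QuantumFieldTheory.Balaban1983to89.B5Hk163Qk
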